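import Literature.NumberTheory.EllipticCurves.KellerYin2024.AnomalousImprimitiveLambdaInvariants
import Summits.BirchSwinnertonDyer.BirchSwinnertonDyer.Theorems.EisensteinPrimesUnrSelmerQuotientTorsionFiniteChar
import HarnessLib

/-!
# Route `EisensteinPrimes` (rung K5), crux 2 `GoodLatticeBDPValue`, line `halves`: the QUOTIENT form of
# [PWL-θ] from the BARE CORANK identity — `(H¹_{𝓕_nr^{Sf}}/H¹_{𝓕_nr})[p]` finite is kernel

Cell `bsd-eis` (home `run/shared/lean/pub/bsd-eis/`), seat `bsd-eis-k5-c2` g11, OPTION (B0), fourth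
pass. The typed `S`-relaxation input for the characters now exists in three strengths in
`Literature/…/KellerYin2024/AnomalousImprimitiveLambdaInvariants.lean`: STRONG §3
(`prop125_…_imprimitive`) ⇐ QUOTIENT §5 (`prop125_…_quotient`) ⇐ CORANK §6 (`prop125_…_corank`),
each implication a KERNEL theorem: §3 ⇐ §5 is `GoodLatticeImprimitiveOfQuotient.prop125_imprimitive_of_quotient`
(p572105, Greenberg–Vatsal Cor. (2.3) for the generic module); §5 ⇐ §6 is THIS file, by
`UnrSelmerQuotientTorsionFiniteChar.finite_torsionBy_unrSelmer_quotient` (p574445: the character module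
is `p`-divisible with `#(·)[p] = p`, the primes over `N_E` are split under (Heeg) hence finitely
decomposed in `K_∞^{ac}` by Brink 2007, Kummer + Milne ADT I.2.9 at each). So skeleton `halves` v14
registers the BARE corank identity (Pollack–Weston A.2 surjectivity + the local `λ`-values of
Lemma 1.1.1, nothing structural) as its character-side [PWL] stub. Route-independent module.

HONEST FRAMING: a theorem between two named statements; nothing booked; BSD is proved for no curve.
-/

set_option linter.dupNamespace false
set_option autoImplicit false

noncomputable section

open scoped Classical

open WeierstrassCurve NumberField IsDedekindDomain Field
  Literature.NumberTheory.EllipticCurves Literature.NumberTheory.EllipticCurves.ModularForms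
  Literature.NumberTheory.QuadraticFields Literature.NumberTheory.EllipticCurves.Rank1Residual
  Literature.NumberTheory.EllipticCurves.Castella2018 Literature.NumberTheory.EllipticCurves.GreenbergSelmer
  Literature.NumberTheory.EllipticCurves.GreenbergVatsal2000 Literature.NumberTheory.GaloisRepresentations
  Literature.NumberTheory.EllipticCurves.CastellaGrossiLeeSkinner2022
  Literature.NumberTheory.EllipticCurves.KellerYin2024
open Summit.BirchSwinnertonDyer.BirchSwinnertonDyer.Theorems

namespace Summit.BirchSwinnertonDyer.BirchSwinnertonDyer.Theorems.GoodLatticeQuotientOfCorank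

/-- **[PWL-θ] QUOTIENT ⇐ [PWL-θ] CORANK**: `prop125_residualPair_unrSelmer_corank` implies
`prop125_residualPair_unrSelmer_quotient` — the missing clause "`(H¹_{𝓕_nr^{Sf}}/H¹_{𝓕_nr})[p]`
finite" is `UnrSelmerQuotientTorsionFiniteChar.finite_torsionBy_unrSelmer_quotient` at the crux's data
(`K` imaginary quadratic, `2 < p`, (Heeg) for `N_E`, `κ` anticyclotomic, `Sf` the primes over `N_E`).
[cite: KellerYin2024, Prop. 1.2.5 and proof (arXiv:2402.12781v2 TeX L780–800)]
[cite: GreenbergVatsal2000, §2 pp. 20–21] [cite: Brink2007, Thm. 2] -/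
theorem prop125_quotient_of_corank (h : prop125_residualPair_unrSelmer_corank) :
    prop125_residualPair_unrSelmer_quotient := by
  intro W _ _ p _ hp hgood hred hanom hlat K _ _ hK hH hHp htor ι v vbar hv hvbar hne κ hκ γ _ θsub θquot
    hpair Sf hSf θ hθ hRH
  have hγ : κ.IsTopGenerator γ := Fact.out
  exact ⟨UnrSelmerQuotientTorsionFiniteChar.finite_torsionBy_unrSelmer_quotient hK hp hH κ hκ hγ vbar θ
      Sf hSf,
    h W p hp hgood hred hanom hlat K hK hH hHp htor ι v vbar hv hvbar hne κ hκ γ θsub θquot hpair Sf hSf θ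
      hθ hRH⟩

end Summit.BirchSwinnertonDyer.BirchSwinnertonDyer.Theorems.GoodLatticeQuotientOfCorank

end
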